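import Summits.BirchSwinnertonDyer.BirchSwinnertonDyer.Theorems.GenusKolyvaginAtTwoGenusPrimitiveSupplyAtTwoTwistUnramifiedMenu
import Summits.BirchSwinnertonDyer.BirchSwinnertonDyer.Theorems.GenusKolyvaginAtTwoMazurRubinCor34ii
import Literature.NumberTheory.EllipticCurves.BSDConductorProofs
import HarnessLib

/-!
# Route `GenusKolyvaginAtTwo`, crux #2 `GenusPrimitiveSupplyAtTwo` (stmt-BirchSwinnertonDyer-22136):
# MAZUR–RUBIN 2010 LEMMA 2.10 PLACE BY PLACE OVER `ℚ` IS A TREE THEOREM — discharge of the named fact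
# `MazurRubin2010.d2_eq_of_lemma210_rat` (`T = ∅`: `#Sel₂(E^F/ℚ) = #Sel₂(E/ℚ)` when every place is on Lemma 2.10's list)

Width seat `bsd-line-gk2-p5` g11 (cell `bsd-f1-sign2`, SUPPLY lineage), file 42 of the series (sequel of `…TwistUnramifiedMenu.lean`).
THEOREMS ONLY (no definition, no named fact, no `sorry`); helper `--supports stmt-BirchSwinnertonDyer-22136`; no item of this route is
closed by it; BSD is not proved by any of this.

WHAT. `Literature.NumberTheory.EllipticCurves.MazurRubin2010.d2_eq_of_lemma210_rat` (Mazur–Rubin, Invent. Math. 181 (2010), Lemma 2.10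
(i)–(v) at every place with Def. 2.3 and the first display of the proof of Prop. 3.3, `T = ∅`, `K = ℚ`): for an elliptic `E/ℚ` (any model
`W`), a square-free `d ≠ 1`, `F = ℚ(√d)`: if at EVERY prime `p` one of (i) `p` splits in `F`, (ii) `p ≠ 2` and `E(ℚ_p)[2] = 0`,
(iii) `E` multiplicative at `p`, `p` unramified in `F`, `ord_p Δ` odd, (v) `E` good at `p`, `p` unramified in `F` holds, and at the real
place `F` is real or `Δ_E < 0`, then `#Sel₂(E^{(d)}) = #Sel₂(E)` for every model of the twist. It was a cite-only named fact with 25+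
consumer files (cells `u2` — `Uniform/U2/GenusTheoryEndToEnd*Placewise*`, `…Lemma210*`, `…Tower*` — and `bsd-f1-sign2`'s T-A⁵
`UnramifiedTwistSelmerShiftAtTwo` / `MixedTwistSelmerLevelAtTwo` lane); the lead's `MazurRubin2010.cor34ii_rat_holds` (p639122) proved the
Cor. 3.4 (ii) sibling, where `2` SPLITS, and recorded this place-wise form as «not dischargeable: row (v) admits `p = 2` good and INERT in
`F`». This file PROVES it (`MazurRubin2010.d2_eq_of_lemma210_rat_holds`): rows (iii) and (v) at `2` INERT (`d ≡ 5 (mod 8)`) are the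
unramified row of the five-row menu (files 37–41: Mazur's norm theorem via Kramer–Tunnell Lemma 6.1 type `I₀`, Kramer 1981 Props. 1, 2 (a),
the Galois-descent bridge, `√d ∈ ℚ_v^{nr}` for `d ≡ 5 (mod 8)` of file 36).

HOW (no duality; Lemma 2.10 place by place, as printed). For each finite place `v` over `p`: if `p` splits in `F` — SPLIT row (§C of the
lead's dictionary); otherwise the hypothesis at `p` is (ii) — SILENT row (`p ≠ 2`; the twist is silent too, §B), (iii)/(v) with `p ∤ d_F`:
for `p ≠ 2` the lead's TAMAGAWA-ODD / BOTH-GOOD rows (§D–§F), for `p = 2` NOT split and unramified: `d_F = d ≡ 5 (mod 8)`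
(`Quadratic.ncard_primesOver_two_eq_two_iff`, `discr_eq_or_eq_four_mul`, `Quadratic.discr_eq_four_mul_of_sq_eq_intCast`), so
`ι√d ∈ ℚ_v^{nr}` (`closureEmb_geomSqrt_mem_maxUnramified_of_emod_eight_eq_five`) and the UNRAMIFIED row applies with `W` good at `v`
resp. multiplicative with `ord_v Δ_min` odd (`odd_ordMinimalDiscriminant_iff_odd_padicValRat`). Real place: `Δ < 0` ⟹ `H¹(ℝ, ·) = 0`
for both; `F` real ⟹ `d > 0` ⟹ split. Then `GenusKolyArch.natCard_selmerGroup_twist_eq_of_menu₅` and model invariance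
`natCard_selmerGroup_smul`.

References: [MazurRubin2010] arXiv:0904.3709 = Invent. Math. 181 (2010): Lemma 2.9, Lemma 2.10 (i)–(v) (DASH copy p0008 L26–L34), Def. 2.3,
proof of Prop. 3.3 first display (p0009 L81–L83); [Mazur1972] Cor. 4.4; [Kramer1981] §2 Props. 1, 2 (a), Prop. 7; [KramerTunnell1982] §6
Lemma 6.1; [SilvermanAEC2009] VII.1, VII.5 Prop. 5.1, X.5 Cor. 5.4; [Marcus2018] Ch. 2 Thm. 1 (`d_F`); [NeukirchANT1999] I (8.5).
-/

set_option linter.dupNamespace false -- tree convention: `Summit.BirchSwinnertonDyer.BirchSwinnertonDyer.Theorems` (summit = sub-problem)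
set_option autoImplicit false

noncomputable section

open scoped Classical ContRepresentation

namespace Summit.BirchSwinnertonDyer.BirchSwinnertonDyer.Theorems.GenusKolyTwistTamagawa

open WeierstrassCurve Field NumberField IsDedekindDomain Function Polynomial
open Literature.NumberTheory.EllipticCurves Literature.NumberTheory.GaloisRepresentations
open Literature.NumberTheory.GaloisCohomology
open Rat.HeightOneSpectrum

/-! ## §H Mazur–Rubin Lemma 2.10 place by place over `ℚ` HOLDS -/

section Main

open Literature.NumberTheory.QuadraticFields
open Summit.BirchSwinnertonDyer.BirchSwinnertonDyer.Theorems.GenusKolyTwistingPrime (primesEquiv_eq natCast_not_mem_of_not_dvd)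
open Summit.BirchSwinnertonDyer.BirchSwinnertonDyer.Theorems.GenusKolyArch (natCard_selmerGroup_twist_eq_of_menu₅
  closureEmb_geomSqrt_mem_maxUnramified_of_emod_eight_eq_five)

/-- **At the place over `2`, NOT split and UNRAMIFIED in `F = ℚ(√d)`, the chosen `ι√d` lies in `ℚ_v^{nr}`**: `2 ∤ d_F` forces
`d_F = d ≡ 1 (mod 4)` (`d_F ∈ {d, 4d}`; `d ≡ 2, 3 (mod 4)` gives `d_F = 4d`), not split forces `d_F ≢ 1 (mod 8)`
(`Quadratic.ncard_primesOver_two_eq_two_iff`), so `d ≡ 5 (mod 8)` and file 36's `closureEmb_geomSqrt_mem_maxUnramified_of_emod_eight_eq_five`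
applies. [cite: Marcus2018, Ch. 2 Thm. 1] [cite: NeukirchANT1999, I (8.5)] [cite: SerreLocalFields1979, Ch. IV §4 Cor. 2 to Prop. 16] -/
theorem closureEmb_mem_maxUnramified_of_not_split {F : Type} [Field F] [NumberField F] (h2 : Module.finrank ℚ F = 2)
    {x : F} {d : ℤ} (hx : x ^ 2 = (d : F)) (hsf : Squarefree d) (hd1 : d ≠ 1) (v : HeightOneSpectrum (𝓞 ℚ))
    (hp2 : ((primesEquiv v : Nat.Primes) : ℕ) = 2)
    (hsplit : ¬ ((Ideal.span {(((primesEquiv v : Nat.Primes) : ℕ) : ℤ)}).primesOver (𝓞 F)).ncard = 2)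
    (hpdisc : ¬ (((primesEquiv v : Nat.Primes) : ℕ) : ℤ) ∣ NumberField.discr F) :
    closureEmb (K := ℚ) (v.adicCompletion ℚ) (geomSqrt (d : ℚ)) ∈
      IsNonarchimedeanLocalField.maxUnramified (v.adicCompletion ℚ) := by
  rw [hp2, Nat.cast_ofNat] at hsplit hpdisc
  have h8 : NumberField.discr F % 8 ≠ 1 := fun h ↦ hsplit ((Quadratic.ncard_primesOver_two_eq_two_iff h2).mpr h)
  have hdiscd : NumberField.discr F = d := by
    rcases discr_eq_or_eq_four_mul h2 hx hsf hd1 with h | h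
    · exact h
    · exfalso; exact hpdisc ⟨2 * d, by rw [h]; ring⟩
  have hd4 : ¬ (d % 4 = 2 ∨ d % 4 = 3) := fun h23 ↦ by
    have h := Quadratic.discr_eq_four_mul_of_sq_eq_intCast h2 hx h23 hsf
    exact hpdisc ⟨2 * d, by rw [h]; ring⟩
  have hd2 : ¬ (2 : ℤ) ∣ d := hdiscd ▸ hpdisc
  rw [hdiscd] at h8
  have hd8 : d % 8 = 5 := by omega
  have h2mem : ((2 : ℕ) : 𝓞 ℚ) ∈ v.asIdeal := by
    refine (natCast_mem_asIdeal_iff_eq_primesEquiv_symm v Nat.prime_two).mpr ?_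
    rw [Equiv.eq_symm_apply]
    exact Subtype.ext hp2
  exact closureEmb_geomSqrt_mem_maxUnramified_of_emod_eight_eq_five v hp2 h2mem hd8

/-- **MAZUR–RUBIN 2010 LEMMA 2.10 (i)–(v) PLACE BY PLACE OVER `ℚ` (`T = ∅`) HOLDS** — DISCHARGE of the named fact
`MazurRubin2010.d2_eq_of_lemma210_rat`: for an elliptic `E/ℚ` (any model `W`), `d` square-free `≠ 1`, `F = ℚ(√d)`: if at every prime
one of Lemma 2.10 (i) [`p` splits], (ii) [`p ≠ 2`, `E(ℚ_p)[2] = 0`], (iii) [multiplicative, unramified, `ord_p Δ` odd], (v) [good,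
unramified] holds, and at the real place (i) [`F` real] or (iv) [`Δ_E < 0`] holds, then `#Sel₂(W') = #Sel₂(W)` for every model `W'` of
`E^{(d)}`. Proof: Lemma 2.10 at every place through the five-row place menu (`natCard_selmerGroup_twist_eq_of_menu₅`) — the new cases
over the lead's `cor34ii_rat_holds` being rows (iii) and (v) at `p = 2` INERT (`d ≡ 5 (mod 8)`: `√d ∈ ℚ_v^{nr}`, Mazur's norm theorem /
Kramer Props. 1, 2 (a)); then model invariance `natCard_selmerGroup_smul`. No duality input.
[cite: MazurRubin2010, Lemma 2.10 (i)–(v) (DASH copy p0008 L26–L34) with Def. 2.3 (p0007 L5–L9); proof of Prop. 3.3, first display (p0009 L81–L83), T = ∅]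
[cite: Kramer1981, §2 Props. 1 and 2 (a) (p. 123), Prop. 7] [cite: KramerTunnell1982, §6 Lemma 6.1 (p. 327), type I₀]
[cite: SilvermanAEC2009, VII.5 Prop. 5.1, X.5 Cor. 5.4] -/
theorem _root_.Literature.NumberTheory.EllipticCurves.MazurRubin2010.d2_eq_of_lemma210_rat_holds :
    MazurRubin2010.d2_eq_of_lemma210_rat := by
  intro W _ d hsf hd1 F _ _ h2 hx hfinp hreal W' _ hW'
  classical
  have hd0 : d ≠ 0 := fun h ↦ by subst h; exact not_squarefree_zero hsf
  have hdQ : (d : ℚ) ≠ 0 := by exact_mod_cast hd0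
  obtain ⟨x, hx⟩ := hx
  haveI hEt := W.isElliptic_quadraticTwist hdQ
  -- `d ∣ d_F` (`d_F ∈ {d, 4d}`)
  have hdisc := discr_eq_or_eq_four_mul h2 hx hsf hd1
  have hd_dvd_disc : d ∣ NumberField.discr F := by
    rcases hdisc with h | h
    · rw [h]
    · rw [h]; exact Dvd.intro_left 4 rfl
  -- the finite place menu for the pair `(W, W^{(d)})`
  have hfin : ∀ v : HeightOneSpectrum (𝓞 ℚ),
      (∃ s : v.adicCompletion ℚ, s ^ 2 = algebraMap ℚ (v.adicCompletion ℚ) (d : ℚ)) ∨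
      (((2 : ℕ) : 𝓞 ℚ) ∉ v.asIdeal ∧
        ¬ 2 ∣ (W.baseChange (v.adicCompletion ℚ)).localTamagawaNumber (v.adicCompletionIntegers ℚ) ∧
        ¬ 2 ∣ ((W.quadraticTwist (d : ℚ)).baseChange (v.adicCompletion ℚ)).localTamagawaNumber
          (v.adicCompletionIntegers ℚ)) ∨
      (((2 : ℕ) : 𝓞 ℚ) ∉ v.asIdeal ∧ W.HasGoodReductionAt v ∧ (W.quadraticTwist (d : ℚ)).HasGoodReductionAt v) ∨
      (((2 : ℕ) : 𝓞 ℚ) ∉ v.asIdeal ∧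
        Nat.card (nsmulAddMonoidHom 2 : (W.baseChange (v.adicCompletion ℚ)).toAffine.Point →+ _).ker = 1 ∧
        Nat.card (nsmulAddMonoidHom 2 :
          ((W.quadraticTwist (d : ℚ)).baseChange (v.adicCompletion ℚ)).toAffine.Point →+ _).ker = 1) ∨
      ((W.HasGoodReductionAt v ∨ (W.HasMultiplicativeReductionAt v ∧ Odd (W.ordMinimalDiscriminant v))) ∧
        closureEmb (K := ℚ) (v.adicCompletion ℚ) (geomSqrt (d : ℚ)) ∈
          IsNonarchimedeanLocalField.maxUnramified (v.adicCompletion ℚ)) := by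
    intro v
    haveI hF : Fact ((primesEquiv v : Nat.Primes) : ℕ).Prime := ⟨(primesEquiv v).2⟩
    by_cases hsplit : ((Ideal.span {(((primesEquiv v : Nat.Primes) : ℕ) : ℤ)}).primesOver (𝓞 F)).ncard = 2
    · exact Or.inl (exists_sq_eq_adicCompletion_of_ncard_primesOver_eq_two h2 hx hsf hd1 v hsplit)
    · -- `v` does not split: read the hypothesis at `p`
      rcases hfinp ((primesEquiv v : Nat.Primes) : ℕ) with hs | ⟨hp2, hW2⟩ | ⟨hmultp, hpdisc, hodd⟩ | ⟨hgoodp, hpdisc⟩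
      · exact absurd hs hsplit
      · -- (ii) SILENT row at an odd prime
        have h2v : ((2 : ℕ) : 𝓞 ℚ) ∉ v.asIdeal := fun h ↦ hp2 (primesEquiv_eq Nat.prime_two h)
        refine Or.inr (Or.inr (Or.inr (Or.inl ⟨h2v, natCard_ker_nsmul_two_adicCompletion_eq_one_of_forall W v hW2, ?_⟩)))
        refine natCard_ker_nsmul_two_adicCompletion_eq_one_of_forall (W.quadraticTwist (d : ℚ)) v ?_
        have hc : Nat.card {Q : ((W.quadraticTwist (d : ℚ)).baseChange
            ℚ_[((primesEquiv v : Nat.Primes) : ℕ)]).toAffine.Point // 2 • Q = 0} = 1 := by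
          rw [natCard_twoTorsion_padic_twist_eq W hdQ (Wd := W.quadraticTwist (d : ℚ)) (C := 1) (one_smul _ _)]
          haveI : Unique {Q : (W.baseChange ℚ_[((primesEquiv v : Nat.Primes) : ℕ)]).toAffine.Point // 2 • Q = 0} :=
            { default := ⟨0, by simp⟩
              uniq := fun Q ↦ Subtype.ext (hW2 Q.1 Q.2) }
          exact Nat.card_unique
        intro Q hQ
        haveI : Finite {Q : ((W.quadraticTwist (d : ℚ)).baseChange
            ℚ_[((primesEquiv v : Nat.Primes) : ℕ)]).toAffine.Point // 2 • Q = 0} :=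
          Nat.finite_of_card_ne_zero (by rw [hc]; norm_num)
        exact congrArg Subtype.val ((Nat.card_eq_one_iff_unique.mp hc).1.elim ⟨Q, hQ⟩ ⟨0, by simp⟩)
      · -- (iii) multiplicative, unramified, `ord_p Δ` odd
        have hpd : ¬ (((primesEquiv v : Nat.Primes) : ℕ) : ℤ) ∣ d := fun h ↦ hpdisc (h.trans hd_dvd_disc)
        have hmult : W.HasMultiplicativeReductionAt v :=
          (hasMultiplicativeReductionAtPrime_iff_hasMultiplicativeReductionAt_ringOfIntegers W v).mp hmultp
        by_cases hp2 : ((primesEquiv v : Nat.Primes) : ℕ) = 2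
        · -- `p = 2` inert: the UNRAMIFIED row (Kramer Props. 1, 2 (a))
          refine Or.inr (Or.inr (Or.inr (Or.inr ⟨Or.inr ⟨hmult, (odd_ordMinimalDiscriminant_iff_odd_padicValRat W v).mpr hodd⟩,
            ?_⟩)))
          exact closureEmb_mem_maxUnramified_of_not_split h2 hx hsf hd1 v hp2 hsplit hpdisc
        · -- odd `p`: TAMAGAWA row
          have h2v : ((2 : ℕ) : 𝓞 ℚ) ∉ v.asIdeal := fun h ↦ hp2 (primesEquiv_eq Nat.prime_two h)
          refine Or.inr (Or.inl ⟨h2v, ?_, ?_⟩)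
          · exact not_two_dvd_localTamagawaNumber_of_mult_of_odd W v hmult
              ((odd_ordMinimalDiscriminant_iff_odd_padicValRat W v).mpr hodd)
          · exact not_two_dvd_localTamagawaNumber_of_mult_of_odd (W.quadraticTwist (d : ℚ)) v
              (hasMultiplicativeReductionAt_quadraticTwist_of_not_dvd_any W v hp2 hpd hmult)
              ((odd_ordMinimalDiscriminant_iff_odd_padicValRat _ v).mpr
                ((odd_padicValRat_Δ_quadraticTwist_iff W hpd).mpr hodd))
      · -- (v) good, unramified
        have hpd : ¬ (((primesEquiv v : Nat.Primes) : ℕ) : ℤ) ∣ d := fun h ↦ hpdisc (h.trans hd_dvd_disc)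
        have hgood : W.HasGoodReductionAt v :=
          (hasGoodReductionAtPrime_iff_hasGoodReductionAt_ringOfIntegers v W).mp hgoodp
        by_cases hp2 : ((primesEquiv v : Nat.Primes) : ℕ) = 2
        · -- `p = 2` inert: the UNRAMIFIED row (Mazur's norm theorem)
          refine Or.inr (Or.inr (Or.inr (Or.inr ⟨Or.inl hgood, ?_⟩)))
          exact closureEmb_mem_maxUnramified_of_not_split h2 hx hsf hd1 v hp2 hsplit hpdisc
        · -- odd `p`: BOTH GOOD
          have h2v : ((2 : ℕ) : 𝓞 ℚ) ∉ v.asIdeal := fun h ↦ hp2 (primesEquiv_eq Nat.prime_two h)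
          exact Or.inr (Or.inr (Or.inl
            ⟨h2v, hgood, hasGoodReductionAt_quadraticTwist_of_not_dvd_any W v hp2 hpd hgood⟩))
  -- the infinite place menu
  have hinf : ∀ w : InfinitePlace ℚ,
      (∃ s : w.Completion, s ^ 2 = algebraMap ℚ w.Completion (d : ℚ)) ∨
      ((∀ y : galoisCohomology (W.localGaloisModule w.Completion) 1, y = 0) ∧
        (∀ y : galoisCohomology ((W.quadraticTwist (d : ℚ)).localGaloisModule w.Completion) 1, y = 0)) := by
    intro w
    rcases hreal with hF | hneg
    · left
      haveI := hF
      have hdpos : 0 < d := pos_of_isTotallyReal_of_sq_eq hx hd0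
      obtain ⟨m, hm⟩ : ∃ m : ℕ, (m : ℤ) = d := ⟨d.natAbs, Int.natAbs_of_nonneg hdpos.le⟩
      obtain ⟨s, hs⟩ := GenusKolyLowering.exists_sq_eq_infinitePlace_completion w m
      refine ⟨s, ?_⟩
      rw [hs, ← hm, Int.cast_natCast]
    · right
      have hneg' : (W.quadraticTwist (d : ℚ)).Δ < 0 := by
        rw [quadraticTwist_Δ]
        exact mul_neg_of_pos_of_neg (by positivity) hneg
      exact ⟨fun y ↦ GenusExact.ArchVanishing.localH1_infinitePlace_eq_zero_of_Δ_neg W w hneg y,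
        fun y ↦ GenusExact.ArchVanishing.localH1_infinitePlace_eq_zero_of_Δ_neg _ w hneg' y⟩
  -- the `T = ∅` law for the twist `W^{(d)}` itself, then transport to the given model `W'`
  have key := natCard_selmerGroup_twist_eq_of_menu₅ W hdQ (Wd := W.quadraticTwist (d : ℚ)) (C := 1)
    (one_smul _ _) hfin hinf
  obtain ⟨C, hC⟩ := hW'
  have hsm := natCard_selmerGroup_smul W' C two_ne_zero
  rw [hC] at hsm
  rw [Nat.cast_ofNat] at key hsm
  rw [← hsm, key]

end Main

end Summit.BirchSwinnertonDyer.BirchSwinnertonDyer.Theorems.GenusKolyTwistTamagawa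

end
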